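import Summits.Langlands.Langlands.Theses.RepeatedRootSocle
import Literature.NumberTheory.GaloisRepresentations.CyclotomicCharacterFrobeniusProofs

/-!
# Disproof of `PadicLimitUnrefined` — findings: the crux (and the target, and the heart) is VACUOUS

Refuter crux-attack at birth (unit rattack-stmt-Langlands-18088, item stmt-Langlands-18088,
route `route-Langlands-RepeatedRootSocle`, 2026-08-17).

**Finding (kernel-checked below, axioms `propext`, `Classical.choice`, `Quot.sound`).**
In all three typed items of the route (`UnrefinedWeightTwoLifting` = stmt-Langlands-18086,
`LimitClassicalUnrefined` = stmt-Langlands-18087, `PadicLimitUnrefined` = stmt-Langlands-18088) the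
hypotheses `Sympl ρ` (symplectic with multiplier `ε⁻¹`, the INVERSE cyclotomic character — the
COHOMOLOGICAL convention of BCGP, `ρ = H¹`) and `Pure ρ` (Frobenius characteristic polynomial
`P ∈ ℤ[X]` with roots of `‖·‖² = q_v` at almost every place — the HOMOLOGICAL convention,
`ρ = V_p A`, arithmetic Frobenius of weight `+1`) are jointly unsatisfiable for a rank-4 framed
representation of `Γ_ℚ`:
* determinants in `ρ(σ)ᵀ J ρ(σ) = ε(σ)⁻¹ • J` (`det J ≠ 0`, `4 × 4`) give `det ρ(σ)² = ε(σ)⁻⁴`;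
* at an arithmetic Frobenius `σ` at any place `v ∤ p` (one exists: `primesAbove_nonempty`,
  `exists_isArithFrobAt_of_mem_primesAbove_holds`), `ε(σ) = N v = q ≥ 2`
  (`GaloisRep.cyclotomicCharacter_apply_of_isArithFrobAt`, Serre I-1.2), while
  `det ρ(σ) = P(0) ∈ ℤ` (`Matrix.det_eq_sign_charpoly_coeff`);
* hence `P(0)² · q⁴ = 1` in `ℤ` — impossible.
Only `Sympl ρ` and the integrality half of `Pure ρ` are used (not `PSh`, `BigRes`, `Cong`, `Aut`,
irreducibility, `p ≠ 2`, nor the Weil-root clause).  Consequently `PadicLimitUnrefined`,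
`UnrefinedWeightTwoLifting` and `LimitClassicalUnrefined` are all provable outright
(`…_vacuous` below) and the route's `closes` degenerates to `SectorComplement ↔ Langlands`.

**Classification: misstated (vacuous), not refutable.**  Minimal repair `C′`: in `Sympl` replace
`(GaloisRep.cyclotomicCharacter ℚ p g)⁻¹` by `GaloisRep.cyclotomicCharacter ℚ p g` (multiplier
`ε`, the homological convention that the rest of the statement — `PSh` shape
`(εα, εβ | β⁻¹, α⁻¹)` = shape (P) of `Literature…WeightTwoOrdinaryDistinguished`, whose docstring
says verbatim "the requesting route uses the HOMOLOGICAL convention … symplectic with multiplier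
`ε`", and `Pure` with `‖z‖² = q_v`, `P ∈ ℤ[X]` — already uses).  With multiplier `ε` the same
determinant computation gives `det ρ(Frob_v) = ±q_v²`, consistent with weight 1; the witness
below then misses `C′`.  (The alternative, all-cohomological repair — shape
`(α, β | ε⁻¹β⁻¹, ε⁻¹α⁻¹)`, roots of `‖·‖² = q_v⁻¹` — loses `P ∈ ℤ[X]` and is not recommended.)
-/

open scoped NumberField
open scoped BigOperators Topology Matrix
open IsDedekindDomain Field Polynomial Filter
open Literature.NumberTheory.GaloisRepresentations

set_option linter.dupNamespace false

namespace Summit.Langlands.Langlands.Cruxes.PadicLimitUnrefined.Disproof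

/-- `ℚ` has infinitely many finite places (a prime of `𝓞 ℚ` above every rational prime).
Local copy of `Literature…SorensenPatching.infinite_heightOneSpectrum` (light imports). [folklore] -/
theorem infinite_heightOneSpectrum (F : Type*) [Field F] [NumberField F] :
    Infinite (HeightOneSpectrum (𝓞 F)) := by
  classical
  have hinj : Function.Injective (algebraMap ℤ (𝓞 F)) := (algebraMap ℤ (𝓞 F)).injective_int
  have key : ∀ p : Nat.Primes, ∃ w : HeightOneSpectrum (𝓞 F),
      w.asIdeal.comap (algebraMap ℤ (𝓞 F)) = Ideal.span {(p : ℤ)} := by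
    intro p
    have hp : Prime (p : ℤ) := Nat.prime_iff_prime_int.mp p.2
    haveI : (Ideal.span {(p : ℤ)}).IsPrime := (Ideal.span_singleton_prime hp.ne_zero).mpr hp
    obtain ⟨Q, -, hQ, hQp⟩ := Ideal.exists_ideal_over_prime_of_isIntegral
      (S := 𝓞 F) (Ideal.span {(p : ℤ)}) ⊥
      (by
        rw [← RingHom.ker_eq_comap_bot, (RingHom.injective_iff_ker_eq_bot _).mp hinj]
        exact bot_le)
    refine ⟨⟨Q, hQ, fun hQbot => hp.ne_zero ?_⟩, hQp⟩
    have hmem : (p : ℤ) ∈ Q.comap (algebraMap ℤ (𝓞 F)) := by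
      rw [hQp]
      exact Ideal.mem_span_singleton_self _
    rw [hQbot, Ideal.mem_comap, Ideal.mem_bot, map_eq_zero_iff _ hinj] at hmem
    exact hmem
  choose f hf using key
  refine Infinite.of_injective f fun p q hpq => ?_
  have h := hf p
  rw [hpq, hf q, Ideal.span_singleton_eq_span_singleton, Int.associated_iff_natAbs,
    Int.natAbs_natCast, Int.natAbs_natCast] at h
  exact Subtype.ext h.symm

variable {p : ℕ} [Fact p.Prime]

/-- Core inconsistency: a rank-4 framed `p`-adic representation of `Γ_ℚ` that is symplectic with
multiplier `ε⁻¹` cannot have an integral Frobenius characteristic polynomial at a place `v ∤ p`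
(`det² = q⁻⁴` versus `det = P(0) ∈ ℤ`). [folklore] -/
theorem false_of_symplInvCyclo_of_integralFrobCharpoly
    (ρ : FramedGaloisRep ℚ (PadicAlgCl p) 4)
    (hS : ρ.IsSymplecticWithMultiplierFun (fun g => algebraMap ℚ_[p] (PadicAlgCl p)
      ((((GaloisRep.cyclotomicCharacter ℚ p g)⁻¹ : ℤ_[p]ˣ) : ℤ_[p]) : ℚ_[p])))
    {v : HeightOneSpectrum (𝓞 ℚ)} (hv : ((p : ℕ) : 𝓞 ℚ) ∉ v.asIdeal)
    {P : ℤ[X]} (hP : ρ.HasFrobCharpolyAt v (P.map (Int.castRingHom (PadicAlgCl p)))) :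
    False := by
  obtain ⟨𝔓, h𝔓⟩ := v.primesAbove_nonempty
  obtain ⟨σ, hσ⟩ := HeightOneSpectrum.exists_isArithFrobAt_of_mem_primesAbove_holds h𝔓
  have hchar : ((ρ σ : GL (Fin 4) (PadicAlgCl p)) : Matrix (Fin 4) (Fin 4) (PadicAlgCl p)).charpoly
      = P.map (Int.castRingHom (PadicAlgCl p)) := hP 𝔓 h𝔓 σ hσ
  obtain ⟨J, -, hJdet, hJ⟩ := hS
  have hσJ := hJ σ
  beta_reduce at hσJ
  set ν : PadicAlgCl p := algebraMap ℚ_[p] (PadicAlgCl p)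
      ((((GaloisRep.cyclotomicCharacter ℚ p σ)⁻¹ : ℤ_[p]ˣ) : ℤ_[p]) : ℚ_[p]) with hν
  have hdet := congrArg Matrix.det hσJ
  rw [Matrix.det_mul, Matrix.det_mul, Matrix.det_transpose, Matrix.det_smul,
    Fintype.card_fin] at hdet
  have hJ0 : J.det ≠ 0 := hJdet.ne_zero
  have key : ((ρ σ : GL (Fin 4) (PadicAlgCl p)) : Matrix (Fin 4) (Fin 4) (PadicAlgCl p)).det ^ 2
      = ν ^ 4 := by
    apply mul_right_cancel₀ hJ0
    linear_combination hdet
  -- the cyclotomic character at the arithmetic Frobenius `σ` is `q = N v`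
  have hε : ((GaloisRep.cyclotomicCharacter ℚ p σ : ℤ_[p]ˣ) : ℤ_[p]) = (v.residueCard : ℤ_[p]) :=
    GaloisRep.cyclotomicCharacter_apply_of_isArithFrobAt hv h𝔓 hσ
  have hνq : ν * (v.residueCard : PadicAlgCl p) = 1 := by
    have h1 : (((GaloisRep.cyclotomicCharacter ℚ p σ)⁻¹ : ℤ_[p]ˣ) : ℤ_[p]) *
        (v.residueCard : ℤ_[p]) = 1 := by
      rw [← hε, Units.inv_mul]
    have h2 := congrArg (fun x : ℤ_[p] => algebraMap ℚ_[p] (PadicAlgCl p) (x : ℚ_[p])) h1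
    simpa [hν] using h2
  -- the determinant is the (integer) constant coefficient of the Frobenius polynomial
  have hdetP : ((ρ σ : GL (Fin 4) (PadicAlgCl p)) : Matrix (Fin 4) (Fin 4) (PadicAlgCl p)).det
      = ((P.coeff 0 : ℤ) : PadicAlgCl p) := by
    rw [Matrix.det_eq_sign_charpoly_coeff, Fintype.card_fin, hchar, Polynomial.coeff_map,
      eq_intCast]
    norm_num
  have hC : ((P.coeff 0 : ℤ) : PadicAlgCl p) ^ 2 * (v.residueCard : PadicAlgCl p) ^ 4 = 1 := by
    rw [← hdetP, key, ← mul_pow, hνq, one_pow]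
  have hZ : (P.coeff 0) ^ 2 * ((v.residueCard : ℕ) : ℤ) ^ 4 = 1 := by
    exact_mod_cast hC
  have hq : (2 : ℤ) ≤ ((v.residueCard : ℕ) : ℤ) := by exact_mod_cast v.one_lt_residueCard
  have hsq : (P.coeff 0) ^ 2 = 1 := Int.eq_one_of_mul_eq_one_right (sq_nonneg _) hZ
  rw [hsq, one_mul] at hZ
  have h16 : (16 : ℤ) ≤ ((v.residueCard : ℕ) : ℤ) ^ 4 := by
    calc (16 : ℤ) = 2 ^ 4 := by norm_num
      _ ≤ ((v.residueCard : ℕ) : ℤ) ^ 4 := by gcongr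
  omega

/-- The hypotheses `Sympl ρ ∧ Pure ρ` of the route items are contradictory: from the `∀ᶠ`-purity
extract one place `v ∤ p` with an integral Frobenius polynomial. [folklore] -/
theorem false_of_sympl_of_pure
    (ρ : FramedGaloisRep ℚ (PadicAlgCl p) 4)
    (hS : ρ.IsSymplecticWithMultiplierFun (fun g => algebraMap ℚ_[p] (PadicAlgCl p)
      ((((GaloisRep.cyclotomicCharacter ℚ p g)⁻¹ : ℤ_[p]ˣ) : ℤ_[p]) : ℚ_[p])))
    (hPure : ∀ᶠ v : HeightOneSpectrum (𝓞 ℚ) in Filter.cofinite, ρ.IsUnramifiedAt v ∧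
      ∃ P : Polynomial ℤ, ρ.HasFrobCharpolyAt v (P.map (Int.castRingHom (PadicAlgCl p))) ∧
        ∀ z : ℂ, (P.map (Int.castRingHom ℂ)).IsRoot z → ‖z‖ ^ 2 = (v.residueCard : ℝ)) :
    False := by
  haveI := infinite_heightOneSpectrum ℚ
  -- only finitely many places contain `p`
  have hfin : ∀ᶠ v : HeightOneSpectrum (𝓞 ℚ) in Filter.cofinite, ((p : ℕ) : 𝓞 ℚ) ∉ v.asIdeal := by
    have hp0 : (Ideal.span {((p : ℕ) : 𝓞 ℚ)} : Ideal (𝓞 ℚ)) ≠ ⊥ := by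
      rw [Ne, Ideal.span_singleton_eq_bot]
      exact_mod_cast (Fact.out : p.Prime).ne_zero
    refine (Ideal.finite_factors hp0).subset ?_ 
    intro v hv
    simp only [Set.mem_compl_iff, Set.mem_setOf_eq, not_not] at hv
    simpa [Ideal.dvd_span_singleton] using hv
  obtain ⟨v, ⟨-, P, hP, -⟩, hv⟩ := (hPure.and hfin).exists
  exact false_of_symplInvCyclo_of_integralFrobCharpoly ρ hS hv hP

/-- `PadicLimitUnrefined` holds VACUOUSLY (its hypotheses `Sympl ρ`, `Pure ρ` are contradictory). -/
theorem PadicLimitUnrefined_vacuous :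
    Summit.Langlands.Langlands.Theses.RepeatedRootSocle.PadicLimitUnrefined := by
  intro p _ _ k _ _ _ _ _ _ _ _ R4 Pl ρ₀ ρ Sympl PSh Pure Cong BigRes Aut Lim
    _ _ _ _ _ _ hSympl _ hPure _ _
  exact (false_of_sympl_of_pure ρ hSympl hPure).elim

/-- The TARGET `UnrefinedWeightTwoLifting` holds vacuously for the same reason. -/
theorem UnrefinedWeightTwoLifting_vacuous :
    Summit.Langlands.Langlands.Theses.RepeatedRootSocle.UnrefinedWeightTwoLifting := by
  intro p _ _ k _ _ _ _ _ _ _ _ R4 Pl ρ₀ ρ Sympl PSh Pure Cong BigRes Aut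
    _ _ _ _ _ _ hSympl _ hPure _ _
  exact (false_of_sympl_of_pure ρ hSympl hPure).elim

/-- The HEART `LimitClassicalUnrefined` holds vacuously for the same reason. -/
theorem LimitClassicalUnrefined_vacuous :
    Summit.Langlands.Langlands.Theses.RepeatedRootSocle.LimitClassicalUnrefined := by
  intro p _ _ k _ _ _ _ _ _ _ _ R4 Pl ρ Sympl PSh Pure BigRes Aut Lim _ hSympl _ hPure _ _
  exact (false_of_sympl_of_pure ρ hSympl hPure).elim


/-! ## The repaired statements `C′` (multiplier `ε`) and the restates-summit probe `S′ → C′`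

The three items with the single change `ε⁻¹ ↦ ε` in `Sympl` (everything else byte-identical to
rev 2 of the route file).  These are NOT filed items (planner's call); they record the refuter's
recommended repair in elaborated form, and the cheap direction of the restates probe:
the repaired target implies the repaired crux (take `ρ_m := ρ` for every `m`), so the crux is a
genuine WEAKENING of the target; the converse direction is exactly the heart
`LimitClassicalUnrefined′` and is not cheap. -/

/-- Repaired target `UnrefinedWeightTwoLifting′`: multiplier `ε` instead of `ε⁻¹`. -/
def UnrefinedWeightTwoLiftingRepaired : Prop :=
  ∀ (p : ℕ) [Fact p.Prime], p ≠ 2 → ∀ (k : Type) [Field k] [CharP k p] [IsAlgClosed k] [TopologicalSpace k] [DiscreteTopology k] (red : Valued.integer (PadicAlgCl p) →+* k) (hcpt : Literature.NumberTheory.Automorphic.isCompact_glFiniteIntegralLevel 4 ℚ) (ι : PadicAlgCl p ≃+* ℂ), let R4 := Literature.NumberTheory.GaloisRepresentations.FramedGaloisRep ℚ (PadicAlgCl p) 4; let Pl := IsDedekindDomain.HeightOneSpectrum (NumberField.RingOfIntegers ℚ); ∀ (ρ₀ ρ : R4), let Sympl := fun r : R4 => r.IsSymplecticWithMultiplierFun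 (fun g => algebraMap ℚ_[p] (PadicAlgCl p) (((Literature.NumberTheory.GaloisRepresentations.GaloisRep.cyclotomicCharacter ℚ p g : ℤ_[p]ˣ) : ℤ_[p]) : ℚ_[p])); let PSh := fun (r : R4) (v : Pl) => ∃ (g : Matrix.GeneralLinearGroup (Fin 4) (PadicAlgCl p)) (α β : Field.absoluteGaloisGroup (v.adicCompletion ℚ) →* (PadicAlgCl p)ˣ), (∀ τ ∈ Literature.NumberTheory.GaloisRepresentations.absInertia (v.adicCompletion ℚ), α τ = 1 ∧ β τ = 1) ∧ ∀ τ, (∀ i j : Fin 4, j < i → (g⁻¹ * r.toLocal v τ * g).val i j = 0) ∧ (g⁻¹ * r.toLocal v τ * g).val 0 1 = 0 ∧ (g⁻¹ * r.toLocal v τ * g).val 2 3 = 0 ∧ (g⁻¹ * r.toLocal v τ * g).val 0 0 = algebraMap ℚ_[p] (PadicAlgCl p) (((Literature.NumberTheory.GaloisRepresentations.GaloisRep.cyclotomicCharacter (v.adicCompletion ℚ) p τ : ℤ_[p]ˣ) : ℤ_[p]) : ℚ_[p]) * α τ ∧ (g⁻¹ * r.toLocal v τ * g).val 1 1 = algebraMap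 ℚ_[p] (PadicAlgCl p) (((Literature.NumberTheory.GaloisRepresentations.GaloisRep.cyclotomicCharacter (v.adicCompletion ℚ) p τ : ℤ_[p]ˣ) : ℤ_[p]) : ℚ_[p]) * β τ ∧ (g⁻¹ * r.toLocal v τ * g).val 2 2 = ((β τ)⁻¹ : (PadicAlgCl p)ˣ) ∧ (g⁻¹ * r.toLocal v τ * g).val 3 3 = ((α τ)⁻¹ : (PadicAlgCl p)ˣ); let Pure := fun r : R4 => ∀ᶠ v : Pl in Filter.cofinite, r.IsUnramifiedAt v ∧ ∃ P : Polynomial ℤ, r.HasFrobCharpolyAt v (P.map (Int.castRingHom (PadicAlgCl p))) ∧ ∀ z : ℂ, (P.map (Int.castRingHom ℂ)).IsRoot z → ‖z‖ ^ 2 = (v.residueCard : ℝ); let Cong := fun r r' : R4 => ∀ᶠ v : Pl in Filter.cofinite, ∃ P P' : Polynomial (Valued.integer (PadicAlgCl p)), r.HasFrobCharpolyAt v (P.map (Valued.integer (PadicAlgCl p)).subtype) ∧ r'.HasFrobCharpolyAt v (P'.map (Valued.integer (PadicAlgCl p)).subtype) ∧ P.map red = P'.map red; let BigRes := fun r : R4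 => ∃ σ : Literature.NumberTheory.GaloisRepresentations.FramedGaloisRep ℚ k 4, (∀ᶠ v : Pl in Filter.cofinite, ∃ (P : Polynomial (Valued.integer (PadicAlgCl p))) (Pb : Polynomial k), r.HasFrobCharpolyAt v (P.map (Valued.integer (PadicAlgCl p)).subtype) ∧ σ.HasFrobCharpolyAt v Pb ∧ P.map red = Pb) ∧ σ.toGaloisRep.IsIrreducible ∧ ∃ x, ((σ x).val.charpoly).Separable; let Aut := fun r : R4 => ∃ π : Literature.NumberTheory.Automorphic.CuspidalAutomorphicRepData 4 ℚ hcpt, π.1.IsLAlgebraic ∧ ∀ᶠ v : Pl in Filter.cofinite, ∃ a : Multiset ℂ, π.1.HasSatakeParamAt v a ∧ r.IsUnramifiedAt v ∧ r.HasFrobCharpolyAt v (Literature.NumberTheory.Automorphic.arithFrobPolyOfSatake ι v.residueCard 1 a); ρ₀.toGaloisRep.IsIrreducible → Sympl ρ₀ → (∀ v : Pl, ((p : ℕ) : NumberField.RingOfIntegers ℚ) ∈ v.asIdeal → PSh ρ₀ v) → Pure ρ₀ → Aut ρ₀ → ρ.toGaloisRep.IsIrreducible → Sympl ρ → (∀ v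 : Pl, ((p : ℕ) : NumberField.RingOfIntegers ℚ) ∈ v.asIdeal → PSh ρ v) → Pure ρ → BigRes ρ → Cong ρ₀ ρ → Aut ρ

/-- Repaired heart `LimitClassicalUnrefined′`: multiplier `ε` instead of `ε⁻¹`. -/
def LimitClassicalUnrefinedRepaired : Prop :=
  ∀ (p : ℕ) [Fact p.Prime], p ≠ 2 → ∀ (k : Type) [Field k] [CharP k p] [IsAlgClosed k] [TopologicalSpace k] [DiscreteTopology k] (red : Valued.integer (PadicAlgCl p) →+* k) (hcpt : Literature.NumberTheory.Automorphic.isCompact_glFiniteIntegralLevel 4 ℚ) (ι : PadicAlgCl p ≃+* ℂ), let R4 := Literature.NumberTheory.GaloisRepresentations.FramedGaloisRep ℚ (PadicAlgCl p) 4; let Pl := IsDedekindDomain.HeightOneSpectrum (NumberField.RingOfIntegers ℚ); ∀ (ρ : R4), let Sympl := fun r : R4 => r.IsSymplecticWithMultiplierFun (fun g => algebraMap ℚ_[p] (PadicAlgCl p) (((Literature.NumberTheory.GaloisRepresentations.GaloisRep.cyclotomicCharacter ℚ p g : ℤ_[p]ˣ) : ℤ_[p]) : ℚ_[p])); let PSh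 := fun (r : R4) (v : Pl) => ∃ (g : Matrix.GeneralLinearGroup (Fin 4) (PadicAlgCl p)) (α β : Field.absoluteGaloisGroup (v.adicCompletion ℚ) →* (PadicAlgCl p)ˣ), (∀ τ ∈ Literature.NumberTheory.GaloisRepresentations.absInertia (v.adicCompletion ℚ), α τ = 1 ∧ β τ = 1) ∧ ∀ τ, (∀ i j : Fin 4, j < i → (g⁻¹ * r.toLocal v τ * g).val i j = 0) ∧ (g⁻¹ * r.toLocal v τ * g).val 0 1 = 0 ∧ (g⁻¹ * r.toLocal v τ * g).val 2 3 = 0 ∧ (g⁻¹ * r.toLocal v τ * g).val 0 0 = algebraMap ℚ_[p] (PadicAlgCl p) (((Literature.NumberTheory.GaloisRepresentations.GaloisRep.cyclotomicCharacter (v.adicCompletion ℚ) p τ : ℤ_[p]ˣ) : ℤ_[p]) : ℚ_[p]) * α τ ∧ (g⁻¹ * r.toLocal v τ * g).val 1 1 = algebraMap ℚ_[p] (PadicAlgCl p) (((Literature.NumberTheory.GaloisRepresentations.GaloisRep.cyclotomicCharacter (v.adicCompletion ℚ) p τ : ℤ_[p]ˣ) : ℤ_[p]) : ℚ_[p]) *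 β τ ∧ (g⁻¹ * r.toLocal v τ * g).val 2 2 = ((β τ)⁻¹ : (PadicAlgCl p)ˣ) ∧ (g⁻¹ * r.toLocal v τ * g).val 3 3 = ((α τ)⁻¹ : (PadicAlgCl p)ˣ); let Pure := fun r : R4 => ∀ᶠ v : Pl in Filter.cofinite, r.IsUnramifiedAt v ∧ ∃ P : Polynomial ℤ, r.HasFrobCharpolyAt v (P.map (Int.castRingHom (PadicAlgCl p))) ∧ ∀ z : ℂ, (P.map (Int.castRingHom ℂ)).IsRoot z → ‖z‖ ^ 2 = (v.residueCard : ℝ); let BigRes := fun r : R4 => ∃ σ : Literature.NumberTheory.GaloisRepresentations.FramedGaloisRep ℚ k 4, (∀ᶠ v : Pl in Filter.cofinite, ∃ (P : Polynomial (Valued.integer (PadicAlgCl p))) (Pb : Polynomial k), r.HasFrobCharpolyAt v (P.map (Valued.integer (PadicAlgCl p)).subtype) ∧ σ.HasFrobCharpolyAt v Pb ∧ P.map red = Pb) ∧ σ.toGaloisRep.IsIrreducible ∧ ∃ x, ((σ x).val.charpoly).Separable; let Aut := fun r : R4 => ∃ π : Literature.NumberTheory.Automorphic.CuspidalAutomorphicRepData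 4 ℚ hcpt, π.1.IsLAlgebraic ∧ ∀ᶠ v : Pl in Filter.cofinite, ∃ a : Multiset ℂ, π.1.HasSatakeParamAt v a ∧ r.IsUnramifiedAt v ∧ r.HasFrobCharpolyAt v (Literature.NumberTheory.Automorphic.arithFrobPolyOfSatake ι v.residueCard 1 a); let Lim := fun r : R4 => ∀ m : ℕ, ∃ r' : R4, Aut r' ∧ ∀ᶠ v : Pl in Filter.cofinite, ∃ P P' : Polynomial (Valued.integer (PadicAlgCl p)), r.HasFrobCharpolyAt v (P.map (Valued.integer (PadicAlgCl p)).subtype) ∧ r'.HasFrobCharpolyAt v (P'.map (Valued.integer (PadicAlgCl p)).subtype) ∧ ∀ i : ℕ, ((p : ℕ) : Valued.integer (PadicAlgCl p)) ^ m ∣ (P - P').coeff i; ρ.toGaloisRep.IsIrreducible → Sympl ρ → (∀ v : Pl, ((p : ℕ) : NumberField.RingOfIntegers ℚ) ∈ v.asIdeal → PSh ρ v) → Pure ρ → BigRes ρ → Lim ρ → Aut ρ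

/-- Repaired crux `PadicLimitUnrefined′`: multiplier `ε` instead of `ε⁻¹`. -/
def PadicLimitUnrefinedRepaired : Prop :=
  ∀ (p : ℕ) [Fact p.Prime], p ≠ 2 → ∀ (k : Type) [Field k] [CharP k p] [IsAlgClosed k] [TopologicalSpace k] [DiscreteTopology k] (red : Valued.integer (PadicAlgCl p) →+* k) (hcpt : Literature.NumberTheory.Automorphic.isCompact_glFiniteIntegralLevel 4 ℚ) (ι : PadicAlgCl p ≃+* ℂ), let R4 := Literature.NumberTheory.GaloisRepresentations.FramedGaloisRep ℚ (PadicAlgCl p) 4; let Pl := IsDedekindDomain.HeightOneSpectrum (NumberField.RingOfIntegers ℚ); ∀ (ρ₀ ρ : R4), let Sympl := fun r : R4 => r.IsSymplecticWithMultiplierFun (fun g => algebraMap ℚ_[p] (PadicAlgCl p) (((Literature.NumberTheory.GaloisRepresentations.GaloisRep.cyclotomicCharacter ℚ p g : ℤ_[p]ˣ) : ℤ_[p]) : ℚ_[p])); let PSh := fun (r : R4) (v : Pl) => ∃ (g : Matrix.GeneralLinearGroup (Fin 4) (PadicAlgCl p)) (α β : Field.absoluteGaloisGroup (v.adicCompletion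 ℚ) →* (PadicAlgCl p)ˣ), (∀ τ ∈ Literature.NumberTheory.GaloisRepresentations.absInertia (v.adicCompletion ℚ), α τ = 1 ∧ β τ = 1) ∧ ∀ τ, (∀ i j : Fin 4, j < i → (g⁻¹ * r.toLocal v τ * g).val i j = 0) ∧ (g⁻¹ * r.toLocal v τ * g).val 0 1 = 0 ∧ (g⁻¹ * r.toLocal v τ * g).val 2 3 = 0 ∧ (g⁻¹ * r.toLocal v τ * g).val 0 0 = algebraMap ℚ_[p] (PadicAlgCl p) (((Literature.NumberTheory.GaloisRepresentations.GaloisRep.cyclotomicCharacter (v.adicCompletion ℚ) p τ : ℤ_[p]ˣ) : ℤ_[p]) : ℚ_[p]) * α τ ∧ (g⁻¹ * r.toLocal v τ * g).val 1 1 = algebraMap ℚ_[p] (PadicAlgCl p) (((Literature.NumberTheory.GaloisRepresentations.GaloisRep.cyclotomicCharacter (v.adicCompletion ℚ) p τ : ℤ_[p]ˣ) : ℤ_[p]) : ℚ_[p]) * β τ ∧ (g⁻¹ * r.toLocal v τ * g).val 2 2 = ((β τ)⁻¹ : (PadicAlgCl p)ˣ) ∧ (g⁻¹ * r.toLocal v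 τ * g).val 3 3 = ((α τ)⁻¹ : (PadicAlgCl p)ˣ); let Pure := fun r : R4 => ∀ᶠ v : Pl in Filter.cofinite, r.IsUnramifiedAt v ∧ ∃ P : Polynomial ℤ, r.HasFrobCharpolyAt v (P.map (Int.castRingHom (PadicAlgCl p))) ∧ ∀ z : ℂ, (P.map (Int.castRingHom ℂ)).IsRoot z → ‖z‖ ^ 2 = (v.residueCard : ℝ); let Cong := fun r r' : R4 => ∀ᶠ v : Pl in Filter.cofinite, ∃ P P' : Polynomial (Valued.integer (PadicAlgCl p)), r.HasFrobCharpolyAt v (P.map (Valued.integer (PadicAlgCl p)).subtype) ∧ r'.HasFrobCharpolyAt v (P'.map (Valued.integer (PadicAlgCl p)).subtype) ∧ P.map red = P'.map red; let BigRes := fun r : R4 => ∃ σ : Literature.NumberTheory.GaloisRepresentations.FramedGaloisRep ℚ k 4, (∀ᶠ v : Pl in Filter.cofinite, ∃ (P : Polynomial (Valued.integer (PadicAlgCl p))) (Pb : Polynomial k), r.HasFrobCharpolyAt v (P.map (Valued.integer (PadicAlgCl p)).subtype) ∧ σ.HasFrobCharpolyAt v Pb ∧ P.map red = Pb) ∧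 σ.toGaloisRep.IsIrreducible ∧ ∃ x, ((σ x).val.charpoly).Separable; let Aut := fun r : R4 => ∃ π : Literature.NumberTheory.Automorphic.CuspidalAutomorphicRepData 4 ℚ hcpt, π.1.IsLAlgebraic ∧ ∀ᶠ v : Pl in Filter.cofinite, ∃ a : Multiset ℂ, π.1.HasSatakeParamAt v a ∧ r.IsUnramifiedAt v ∧ r.HasFrobCharpolyAt v (Literature.NumberTheory.Automorphic.arithFrobPolyOfSatake ι v.residueCard 1 a); let Lim := fun r : R4 => ∀ m : ℕ, ∃ r' : R4, Aut r' ∧ ∀ᶠ v : Pl in Filter.cofinite, ∃ P P' : Polynomial (Valued.integer (PadicAlgCl p)), r.HasFrobCharpolyAt v (P.map (Valued.integer (PadicAlgCl p)).subtype) ∧ r'.HasFrobCharpolyAt v (P'.map (Valued.integer (PadicAlgCl p)).subtype) ∧ ∀ i : ℕ, ((p : ℕ) : Valued.integer (PadicAlgCl p)) ^ m ∣ (P - P').coeff i; ρ₀.toGaloisRep.IsIrreducible → Sympl ρ₀ → (∀ v : Pl, ((p : ℕ) : NumberField.RingOfIntegers ℚ) ∈ v.asIdeal → PSh ρ₀ v)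 → Pure ρ₀ → Aut ρ₀ → ρ.toGaloisRep.IsIrreducible → Sympl ρ → (∀ v : Pl, ((p : ℕ) : NumberField.RingOfIntegers ℚ) ∈ v.asIdeal → PSh ρ v) → Pure ρ → BigRes ρ → Cong ρ₀ ρ → Lim ρ

/-- Restates probe `S′ → C′`: the repaired target implies the repaired crux trivially
(`ρ_m := ρ`, `P = P'` from `Cong`).  So `C′` is at most as strong as `S′`. [folklore] -/
theorem padicLimitUnrefinedRepaired_of_target (hS : UnrefinedWeightTwoLiftingRepaired) :
    PadicLimitUnrefinedRepaired := by
  intro p _ hp k _ _ _ _ _ red hcpt ι R4 Pl ρ₀ ρ Sympl PSh Pure Cong BigRes Aut Lim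
    h1 h2 h3 h4 h5 h6 h7 h8 h9 h10 h11 m
  have hA : Aut ρ := hS p hp k red hcpt ι ρ₀ ρ h1 h2 h3 h4 h5 h6 h7 h8 h9 h10 h11
  refine ⟨ρ, hA, ?_⟩
  filter_upwards [h11] with v hv
  obtain ⟨P, P', -, hP', -⟩ := hv
  exact ⟨P', P', hP', hP', fun i => by simp⟩

/-- The repaired assembly still closes: `C′ → Heart′ → S′` (pure logic, as in the route's
`closes`). [folklore] -/
theorem target_of_repaired (hP : PadicLimitUnrefinedRepaired) (hC : LimitClassicalUnrefinedRepaired) :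
    UnrefinedWeightTwoLiftingRepaired := by
  intro p _ hp k _ _ _ _ _ red hcpt ι R4 Pl ρ₀ ρ Sympl PSh Pure Cong BigRes Aut
    h1 h2 h3 h4 h5 h6 h7 h8 h9 h10 h11
  exact hC p hp k red hcpt ι ρ h6 h7 h8 h9 h10
    (hP p hp k red hcpt ι ρ₀ ρ h1 h2 h3 h4 h5 h6 h7 h8 h9 h10 h11)

end Summit.Langlands.Langlands.Cruxes.PadicLimitUnrefined.Disproof
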